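import Literature.NumberTheory.LFunctions.SchoenfeldZerosLow
import HarnessLib

/-!
# Explicit closed-form bounds for the two zero sums above height `2516`

Topic: `Literature/NumberTheory/LFunctions`. THEOREMS (everything proved). Third analytic step of the
discharge of `Literature.NumberTheory.LFunctions.schoenfeld_explicit` (Schoenfeld 1976, Thm. 10 / Cor. 1). From
`SchoenfeldZeroSums.lean` (partial summation against `N(t)`, `N⁻ ≤ N ≤ N⁺`) and
`SchoenfeldZerosLow.lean` (the sums at height `T₀ = 2516`: `sumInvNorm 2516 ≤ 5.681`, `N(2516) = 2000`)
we derive, for `T ≥ 2516` (the tail under RH), the closed forms that enter the final estimate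
(Rosser–Schoenfeld 1975, Lemma 9 / Schoenfeld 1976, Lemma 9 play this role in print):

* `argBound_le` — `Σ(t) ≤ σ₀ + σ₁ log t ≤ 34.6 + 6.67 log t` for `t ≥ 2516`
  (`σ₁ = 1/log(7/6) + 1/6 = 6.6538…`, `σ₀ = 3 + (log 120 + 5/2516)/log(7/6) + 1/(6·2516) = 34.07…`;
  numerically majorised through `log(7/6) ≥ 2/13`, `log 120 ≤ 7 log 2`); `count_le_nUp`, `nLo_le_count` —
  `N⁻(t) ≤ N(t) ≤ N⁺(t)` with `N±(t) = t log t/(2π) − (1 + log 2π)t/(2π) + 7/8 ± (34.6 + 0.3725/t + 6.67 log t)`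
  (`2K/π ≤ 0.3725`, `K = stirlingVertRate (1/4)`, the Stirling error of `θ/π`).
* `sumInvNorm_le_explicit` — **`sumInvNorm T ≤ log²(T/2π)/(2π) + C₁`**, with the constant
  `C₁ = 5.681 − 2F_a(2516) − (1 + log 2π)/π − log²(2π)/(2π)` (`F_a` the antiderivative of
  `(N⁺(t) − 2000)/t²`); numerically `C₁ ≈ 0.04`.
* `tail_le_explicit` — **`β − sumInvNormSq T ≤ 2G(T)`**,
  `G(T) = (log(T/2π) + 1)/(2πT) + (72.535 + 13.34 log T)/T² + 1.8625/(3T³)`: for every `U ≥ T`,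
  `∑_{T<γ≤U} m/γ² ≤ (N⁺(U) − N⁻(T))/U² + ∫_T^U 2(N⁺(t) − N⁻(T))/t³ dt = G(T) − R(U)` with
  `R(U) = (log U + 1 − log 2π)/(2πU) + 3.335/U² − 0.3725/(3U³) ≥ 0` (`sum_zerosBetween_le_Gtail`), and the
  tail is the supremum of these finite sums (`tail_le_of_forall_sum_le`).

## References

* J. B. Rosser, L. Schoenfeld, Math. Comp. 29 (1975), 243–269, Lemmas 7–9. [RosserSchoenfeld1975]
* L. Schoenfeld, Math. Comp. 30 (1976), 337–360, Lemma 9 and the proof of Thm. 10. [Schoenfeld1976]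
-/

noncomputable section

open Complex Filter Set MeasureTheory Topology intervalIntegral
open scoped Real

namespace Literature.NumberTheory.LFunctions

namespace SchoenfeldBound

open NicolasJExplicit ZetaNumerics.Mertens

/-! ### Constants and the linear majorant of `Σ(t)` -/

/-- `σ₁ = 1/log(7/6) + 1/6`. [folklore] -/
def sig1 : ℝ := 1 / Real.log (7 / 6) + 1 / 6

/-- `σ₀ = 3 + (log 120 + 5/2516)/log(7/6) + 1/(6·2516)`. [folklore] -/
def sig0 : ℝ := 3 + (Real.log 120 + 5 / 2516) / Real.log (7 / 6) + 1 / (6 * 2516)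

/-- `2/13 ≤ log(7/6)` (`log(1 + 1/a) ≥ 2/(2a+1)` at `a = 6`). [folklore] -/
theorem log_seven_sixths_ge : 2 / 13 ≤ Real.log (7 / 6) := by
  have h := Literature.Analysis.SpecialFunctions.Real.two_div_le_log_one_add_inv (a := 6) (by norm_num)
  norm_num at h
  exact h

/-- `0 < log(7/6)`. [folklore] -/
theorem log_seven_sixths_pos : 0 < Real.log (7 / 6) := lt_of_lt_of_le (by norm_num) log_seven_sixths_ge

/-- `0 < σ₁ ≤ 6.67` (`1/log(7/6) ≤ 13/2`). [folklore] -/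
theorem sig1_pos_le : 0 < sig1 ∧ sig1 ≤ 6.67 := by
  unfold sig1
  have h0 := log_seven_sixths_pos
  have h1 : 1 / Real.log (7 / 6) ≤ 13 / 2 := by
    rw [div_le_iff₀ h0]; linarith [log_seven_sixths_ge]
  exact ⟨by positivity, by linarith⟩

/-- `0 < σ₀ ≤ 34.6` (`log 120 ≤ 7 log 2 < 4.8521`, `1/log(7/6) ≤ 13/2`). [folklore] -/
theorem sig0_pos_le : 0 < sig0 ∧ sig0 ≤ 34.6 := by
  unfold sig0
  have h0 := log_seven_sixths_pos
  have h120 : Real.log 120 ≤ 4.8521 := by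
    have h : Real.log 120 ≤ Real.log (2 ^ 7) := Real.log_le_log (by norm_num) (by norm_num)
    rw [Real.log_pow] at h
    have := Real.log_two_lt_d9
    push_cast at h
    linarith
  have h120' : 0 < Real.log 120 := Real.log_pos (by norm_num)
  have h1 : (Real.log 120 + 5 / 2516) / Real.log (7 / 6) ≤ (4.8521 + 5 / 2516) * (13 / 2) := by
    rw [div_le_iff₀ h0]
    have := log_seven_sixths_ge
    nlinarith
  exact ⟨by positivity, by norm_num at h1 ⊢; linarith⟩

/-- `2K/π ≤ 0.3725`, `K = stirlingVertRate (1/4) = 1/6 + π/12 + 1/32 + 1/8` (the Stirling error of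
`θ(t)/π` is `≤ (2K/π)/t`). [folklore] -/
theorem two_stirlingVertRate_div_pi_le : 0 < 2 * stirlingVertRate (1 / 4) / π ∧
    2 * stirlingVertRate (1 / 4) / π ≤ 0.3725 := by
  unfold stirlingVertRate
  have hπ := Real.pi_gt_d6
  have hπ' := Real.pi_lt_d6
  constructor
  · positivity
  · rw [div_le_iff₀ (by linarith)]
    nlinarith

/-- `log(t + a) ≤ log t + a/t` for `t > 0`, `a ≥ 0`. [folklore] -/
theorem log_add_le {t a : ℝ} (ht : 0 < t) (ha : 0 ≤ a) : Real.log (t + a) ≤ Real.log t + a / t := by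
  have h : Real.log (t + a) - Real.log t = Real.log (1 + a / t) := by
    rw [← Real.log_div (by linarith) ht.ne']
    congr 1
    field_simp
  have := Real.log_le_sub_one_of_pos (show 0 < 1 + a / t by positivity)
  linarith

/-- `Σ(t) ≤ σ₀ + σ₁ log t` for `t ≥ 2516` (`log(120(t+5)) = log 120 + log(t+5)`,
`log(t + a) ≤ log t + a/t ≤ log t + a/2516`). [folklore] -/
theorem argBound_le_sig {t : ℝ} (ht : 2516 ≤ t) : argBound t ≤ sig0 + sig1 * Real.log t := by
  have ht0 : 0 < t := by linarith
  have h76 := log_seven_sixths_pos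
  have h5 := log_add_le ht0 (by norm_num : (0 : ℝ) ≤ 5)
  have h1 := log_add_le ht0 (by norm_num : (0 : ℝ) ≤ 1)
  have h5' : 5 / t ≤ 5 / 2516 := div_le_div_of_nonneg_left (by norm_num) (by norm_num) ht
  have h1' : 1 / t ≤ 1 / 2516 := div_le_div_of_nonneg_left (by norm_num) (by norm_num) ht
  have hmul : Real.log (120 * (t + 5)) = Real.log 120 + Real.log (t + 5) :=
    Real.log_mul (by norm_num) (by linarith)
  unfold argBound sig0 sig1
  rw [hmul]
  have hA : (Real.log 120 + Real.log (t + 5)) / Real.log (7 / 6) ≤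
      (Real.log 120 + 5 / 2516) / Real.log (7 / 6) + 1 / Real.log (7 / 6) * Real.log t :=
    calc (Real.log 120 + Real.log (t + 5)) / Real.log (7 / 6)
        ≤ (Real.log 120 + 5 / 2516 + Real.log t) / Real.log (7 / 6) :=
          div_le_div_of_nonneg_right (by linarith) h76.le
      _ = (Real.log 120 + 5 / 2516) / Real.log (7 / 6) + 1 / Real.log (7 / 6) * Real.log t := by ring
  have hB : Real.log (t + 1) / 6 ≤ 1 / (6 * 2516) + 1 / 6 * Real.log t := by
    linarith
  linarith

/-- **`Σ(t) ≤ 34.6 + 6.67 log t` for `t ≥ 2516`.** [folklore] -/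
theorem argBound_le {t : ℝ} (ht : 2516 ≤ t) : argBound t ≤ 34.6 + 6.67 * Real.log t := by
  have h := argBound_le_sig ht
  have hl : 0 ≤ Real.log t := Real.log_nonneg (by linarith)
  have h0 := sig0_pos_le
  have h1 := sig1_pos_le
  nlinarith

/-! ### `N⁻ ≤ N ≤ N⁺` with the linear majorant -/

/-- `N⁺(t) = t log t/(2π) − (1 + log 2π)t/(2π) + 7/8 + 34.6 + 0.3725/t + 6.67 log t`
(the Riemann–von Mangoldt main term plus numerical majorants of the Stirling and `S(t)` errors).
[cite: Titchmarsh1986, Thm. 9.4] -/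
def nUp (t : ℝ) : ℝ :=
  t * Real.log t / (2 * π) - (1 + Real.log (2 * π)) * t / (2 * π) + (7 / 8 + 34.6) + 0.3725 / t +
    6.67 * Real.log t

/-- `N⁻(t) = t log t/(2π) − (1 + log 2π)t/(2π) + 7/8 − 34.6 − 0.3725/t − 6.67 log t`.
[cite: Titchmarsh1986, Thm. 9.4] -/
def nLo (t : ℝ) : ℝ :=
  t * Real.log t / (2 * π) - (1 + Real.log (2 * π)) * t / (2 * π) + (7 / 8 - 34.6) - 0.3725 / t -
    6.67 * Real.log t

/-- `countMain t = t log t/(2π) − (1 + log 2π) t/(2π) + 7/8` (`log(t/2π) = log t − log 2π`). [folklore] -/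
theorem countMain_eq {t : ℝ} (ht : 0 < t) :
    countMain t = t * Real.log t / (2 * π) - (1 + Real.log (2 * π)) * t / (2 * π) + 7 / 8 := by
  unfold countMain
  rw [Real.log_div ht.ne' (by positivity)]
  ring

/-- **`N(t) ≤ N⁺(t)` for `t ≥ 2516`.** [cite: Titchmarsh1986, Thm. 9.4] -/
theorem count_le_nUp {t : ℝ} (ht : 2516 ≤ t) : (zetaZeroCount t : ℝ) ≤ nUp t := by
  have h := zetaZeroCount_le_countUpper (t := t) (by linarith)
  have hSig := argBound_le ht
  have hK := two_stirlingVertRate_div_pi_le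
  have ht0 : 0 < t := by linarith
  unfold countUpper at h
  rw [countMain_eq ht0] at h
  unfold nUp
  have e : 2 * stirlingVertRate (1 / 4) / (π * t) = 2 * stirlingVertRate (1 / 4) / π / t := by
    rw [div_div]
  have hle : 2 * stirlingVertRate (1 / 4) / π / t ≤ 0.3725 / t :=
    div_le_div_of_nonneg_right hK.2 ht0.le
  linarith

/-- **`N⁻(t) ≤ N(t)` for `t ≥ 2516`.** [cite: Titchmarsh1986, Thm. 9.4] -/
theorem nLo_le_count {t : ℝ} (ht : 2516 ≤ t) : nLo t ≤ (zetaZeroCount t : ℝ) := by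
  have h := countLower_le_zetaZeroCount (t := t) (by linarith)
  have hSig := argBound_le ht
  have hK := two_stirlingVertRate_div_pi_le
  have ht0 : 0 < t := by linarith
  unfold countLower at h
  rw [countMain_eq ht0] at h
  unfold nLo
  have e : 2 * stirlingVertRate (1 / 4) / (π * t) = 2 * stirlingVertRate (1 / 4) / π / t := by
    rw [div_div]
  have hle : 2 * stirlingVertRate (1 / 4) / π / t ≤ 0.3725 / t :=
    div_le_div_of_nonneg_right hK.2 ht0.le
  linarith

/-- `N⁺` is continuous on `[a, b]`, `a > 0`. [folklore] -/
theorem continuousOn_nUp {a b : ℝ} (ha : 0 < a) : ContinuousOn nUp (Icc a b) := by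
  refine fun t ht ↦ ContinuousAt.continuousWithinAt ?_
  have ht0 : t ≠ 0 := (ha.trans_le ht.1).ne'
  unfold nUp
  fun_prop (disch := assumption)

/-- `N(2516) = 2000`, in `ℝ`. [cite: OdlyzkoTeRiele1985, §4.1 p. 150] -/
theorem zetaZeroCount_2516 : (zetaZeroCount 2516 : ℝ) = 2000 := by
  have h := zetaZeroCount_heightT0
  have e : ((heightT0 : ℕ) : ℝ) = 2516 := by unfold heightT0; norm_num
  rw [← e, h]; norm_num

/-- `N⁺` is continuous at every `t ≠ 0`. [folklore] -/
@[fun_prop]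
theorem continuousAt_nUp {t : ℝ} (ht : t ≠ 0) : ContinuousAt nUp t := by
  unfold nUp
  fun_prop (disch := assumption)

/-! ### `sumInvNorm T ≤ log²(T/2π)/(2π) + C₁` -/

/-- The antiderivative `F_a` of `(N⁺(t) − 2000)/t²`:
`F_a(t) = log²t/(4π) − (1 + log 2π) log t/(2π) − (7/8 + 34.6 − 2000)/t − 0.3725/(2t²) − 6.67(log t + 1)/t`.
[cite: RosserSchoenfeld1975, Lemma 7] -/
def Fa (t : ℝ) : ℝ :=
  Real.log t ^ 2 / (4 * π) - (1 + Real.log (2 * π)) / (2 * π) * Real.log t -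
    (7 / 8 + 34.6 - 2000) * t⁻¹ - 0.3725 / 2 * (t ^ 2)⁻¹ - 6.67 * (Real.log t + 1) * t⁻¹

/-- `d/dt (1/t²) = −2/t³`. [folklore] -/
theorem hasDerivAt_inv_sq {t : ℝ} (ht : t ≠ 0) : HasDerivAt (fun y : ℝ ↦ (y ^ 2)⁻¹) (-2 / t ^ 3) t := by
  have h := (hasDerivAt_pow 2 t).inv (by positivity)
  refine h.congr_deriv ?_
  field_simp
  ring

/-- `d/dt (1/t³) = −3/t⁴`. [folklore] -/
theorem hasDerivAt_inv_cube {t : ℝ} (ht : t ≠ 0) : HasDerivAt (fun y : ℝ ↦ (y ^ 3)⁻¹) (-3 / t ^ 4) t := by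
  have h := (hasDerivAt_pow 3 t).inv (by positivity)
  refine h.congr_deriv ?_
  field_simp
  ring

/-- `F_a' = (N⁺(t) − 2000)/t²` (`t > 0`). [folklore] -/
theorem hasDerivAt_Fa {t : ℝ} (ht : 0 < t) : HasDerivAt Fa ((nUp t - 2000) * (t ^ 2)⁻¹) t := by
  have ht0 : t ≠ 0 := ht.ne'
  have hπ : π ≠ 0 := Real.pi_ne_zero
  have hl : HasDerivAt Real.log t⁻¹ t := Real.hasDerivAt_log ht0
  have hinv : HasDerivAt (fun y : ℝ ↦ y⁻¹) (-(t ^ 2)⁻¹) t := hasDerivAt_inv ht0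
  have hinv2 := hasDerivAt_inv_sq ht0
  have h := (((((hl.pow 2).div_const (4 * π)).sub (hl.const_mul ((1 + Real.log (2 * π)) / (2 * π)))).sub
    (hinv.const_mul (7 / 8 + 34.6 - 2000))).sub (hinv2.const_mul (0.3725 / 2))).sub
    (((hl.add_const 1).const_mul 6.67).mul hinv)
  refine h.congr_deriv ?_
  unfold nUp
  field_simp
  ring

/-- The constant `C₁ = 5.681 − 2F_a(2516) − (1 + log 2π)/π − log²(2π)/(2π)` of `sumInvNorm_le_explicit`
(numerically `≈ −0.13`). [cite: Schoenfeld1976, proof of Thm. 10] -/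
def C1 : ℝ := 5.681 - 2 * Fa 2516 - (1 + Real.log (2 * π)) / π - Real.log (2 * π) ^ 2 / (2 * π)

/-- The closed form of the partial summation: for `T > 0`,
`5.681 + 2((N⁺(T) − 2000)/T + F_a(T) − F_a(2516)) = log²(T/2π)/(2π) + C₁ − 13.34/T + 0.3725/T²`. [folklore] -/
theorem Aform_eq {T : ℝ} (hT : 0 < T) :
    5.681 + 2 * ((nUp T - 2000) * T⁻¹ + (Fa T - Fa 2516)) =
      Real.log (T / (2 * π)) ^ 2 / (2 * π) + C1 - 2 * 6.67 * T⁻¹ + 0.3725 * (T ^ 2)⁻¹ := by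
  have hπ := Real.pi_pos
  unfold C1
  generalize Fa 2516 = F0
  unfold nUp Fa
  rw [Real.log_div hT.ne' (by positivity)]
  field_simp
  ring

/-- **`sumInvNorm T ≤ log²(T/2π)/(2π) + C₁` for `T ≥ 2516`** (no hypothesis; partial summation from
`T₀ = 2516` with `N ≤ N⁺`, `N(2516) = 2000`, `sumInvNorm 2516 ≤ 5.681`; the exact closed form is
`log²(T/2π)/(2π) + C₁ − 13.34/T + 0.3725/T²`, and `0.3725/T² ≤ 13.34/T`). [cite: Schoenfeld1976, Lemma 9] -/
theorem sumInvNorm_le_explicit {T : ℝ} (hT : 2516 ≤ T) :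
    sumInvNorm T ≤ Real.log (T / (2 * π)) ^ 2 / (2 * π) + C1 := by
  have hT0 : 0 < T := by linarith
  -- partial summation between 2516 and T with `f = 1/t`
  have h1 := sumInvNorm_sub_le (T₁ := 2516) (T₂ := T) (by norm_num) hT
  have h2 := sum_zerosBetween_le_of_count_le (T₁ := 2516) (T₂ := T) (by norm_num) hT
    (f := fun t ↦ t⁻¹) (f' := fun t ↦ -(t ^ 2)⁻¹) (Nup := nUp)
    (fun t ht ↦ hasDerivAt_inv (by linarith [ht.1] : t ≠ 0))
    (continuousOn_of_forall_continuousAt fun t ht ↦ by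
      have h0 : t ≠ 0 := by linarith [ht.1]
      have h2 : t ^ 2 ≠ 0 := pow_ne_zero 2 h0
      fun_prop (disch := assumption))
    (fun t ht ↦ by
      have : 0 < t := by linarith [ht.1]
      have : 0 < (t ^ 2)⁻¹ := by positivity
      linarith)
    (by positivity) (fun t ht ↦ count_le_nUp ht.1) (continuousOn_nUp (by norm_num))
  rw [zetaZeroCount_2516] at h2
  -- the integral in closed form
  have hint : ∫ t in (2516 : ℝ)..T, (nUp t - 2000) * -(-(t ^ 2)⁻¹) = Fa T - Fa 2516 := by
    have e : ∀ t ∈ uIcc (2516 : ℝ) T, (nUp t - 2000) * -(-(t ^ 2)⁻¹) = (nUp t - 2000) * (t ^ 2)⁻¹ :=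
      fun t _ ↦ by ring
    rw [integral_congr e]
    refine integral_eq_sub_of_hasDerivAt (fun t ht ↦ hasDerivAt_Fa ?_) ?_
    · rw [uIcc_of_le hT] at ht; linarith [ht.1]
    · refine ContinuousOn.intervalIntegrable_of_Icc hT (continuousOn_of_forall_continuousAt fun t ht ↦ ?_)
      have h0 : t ≠ 0 := by linarith [ht.1]
      have h2 : t ^ 2 ≠ 0 := pow_ne_zero 2 h0
      fun_prop (disch := assumption)
  rw [hint] at h2
  have hA0 : sumInvNorm 2516 ≤ 5.681 := by
    have h := sumInvNorm_heightT0_le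
    have e : ((heightT0 : ℕ) : ℝ) = 2516 := by unfold heightT0; norm_num
    rwa [e] at h
  have hdrop : -(2 * 6.67 * T⁻¹) + 0.3725 * (T ^ 2)⁻¹ ≤ 0 := by
    have hT1 : (0.3725 : ℝ) * (T ^ 2)⁻¹ ≤ 2 * 6.67 * T⁻¹ := by
      rw [show (0.3725 : ℝ) * (T ^ 2)⁻¹ = (0.3725 / T) * T⁻¹ by field_simp]
      refine mul_le_mul_of_nonneg_right ?_ (by positivity)
      rw [div_le_iff₀ hT0]; nlinarith
    linarith
  have := Aform_eq hT0
  linarith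

/-! ### `β − sumInvNormSq T ≤ 2G(T)` -/

/-- The antiderivative `F_b` of `2(N⁺(t) − c)/t³`:
`F_b(c, t) = −(log t + 1)/(πt) + (1 + log 2π)/(πt) − (7/8 + 34.6)/t² − 0.745/(3t³) − 6.67(log t + ½)/t² + c/t²`.
[cite: RosserSchoenfeld1975, Lemma 7] -/
def Fb (c t : ℝ) : ℝ :=
  -(Real.log t + 1) / π * t⁻¹ + (1 + Real.log (2 * π)) / π * t⁻¹ - (7 / 8 + 34.6) * (t ^ 2)⁻¹ -
    2 * 0.3725 / 3 * (t ^ 3)⁻¹ - 6.67 * (Real.log t + 1 / 2) * (t ^ 2)⁻¹ + c * (t ^ 2)⁻¹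

/-- `∂F_b/∂t = 2(N⁺(t) − c)/t³` (`t > 0`). [folklore] -/
theorem hasDerivAt_Fb (c : ℝ) {t : ℝ} (ht : 0 < t) :
    HasDerivAt (Fb c) ((nUp t - c) * (2 / t ^ 3)) t := by
  have ht0 : t ≠ 0 := ht.ne'
  have hπ : π ≠ 0 := Real.pi_ne_zero
  have hl : HasDerivAt Real.log t⁻¹ t := Real.hasDerivAt_log ht0
  have hinv : HasDerivAt (fun y : ℝ ↦ y⁻¹) (-(t ^ 2)⁻¹) t := hasDerivAt_inv ht0
  have hinv2 := hasDerivAt_inv_sq ht0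
  have hinv3 := hasDerivAt_inv_cube ht0
  have h := ((((((hl.add_const 1).neg.div_const π).mul hinv).add (hinv.const_mul ((1 + Real.log (2 * π)) / π))).sub
    (hinv2.const_mul (7 / 8 + 34.6))).sub (hinv3.const_mul (2 * 0.3725 / 3))).sub
    (((hl.add_const (1 / 2)).const_mul 6.67).mul hinv2) |>.add (hinv2.const_mul c)
  refine h.congr_deriv ?_
  unfold nUp
  simp only [Pi.neg_apply]
  field_simp
  ring

/-- `G(T) = (log(T/2π) + 1)/(2πT) + (72.535 + 13.34 log T)/T² + 1.8625/(3T³)`: the explicit bound for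
`∑_{γ > T} m/γ²`. [cite: Schoenfeld1976, Lemma 9] -/
def Gtail (T : ℝ) : ℝ :=
  (Real.log (T / (2 * π)) + 1) / (2 * π) * T⁻¹ + (2 * 34.6 + 6.67 / 2 + 2 * 6.67 * Real.log T) * (T ^ 2)⁻¹ +
    5 * 0.3725 / 3 * (T ^ 3)⁻¹

/-- `−F_b(N⁻(T), T) = G(T)` (`T > 0`). [folklore] -/
theorem neg_Fb_nLo_eq {T : ℝ} (hT : 0 < T) : -Fb (nLo T) T = Gtail T := by
  have hπ := Real.pi_pos
  unfold Fb nLo Gtail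
  rw [Real.log_div hT.ne' (by positivity)]
  field_simp
  ring

/-- The boundary term plus the antiderivative at `U`:
`(N⁺(U) − c)/U² + F_b(c, U) = −[(log U + 1 − log 2π)/(2πU) + 3.335/U² − 0.3725/(3U³)]`. [folklore] -/
theorem boundary_add_Fb_eq (c : ℝ) {U : ℝ} (hU : 0 < U) :
    (nUp U - c) * (U ^ 2)⁻¹ + Fb c U =
      -((Real.log U + 1 - Real.log (2 * π)) / (2 * π) * U⁻¹ + 6.67 / 2 * (U ^ 2)⁻¹ - 0.3725 / 3 * (U ^ 3)⁻¹) := by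
  have hπ := Real.pi_pos
  unfold nUp Fb
  field_simp
  ring

/-- The `U`-dependent remainder is non-positive for `U ≥ 2516`:
`(log U + 1 − log 2π)/(2πU) + 3.335/U² − 0.3725/(3U³) ≥ 0`. [folklore] -/
theorem remainder_nonneg {U : ℝ} (hU : 2516 ≤ U) :
    0 ≤ (Real.log U + 1 - Real.log (2 * π)) / (2 * π) * U⁻¹ + 6.67 / 2 * (U ^ 2)⁻¹ - 0.3725 / 3 * (U ^ 3)⁻¹ := by
  have hU0 : 0 < U := by linarith
  have hπ := Real.pi_pos
  have hlog2π : Real.log (2 * π) < 2 := by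
    rw [Real.log_mul two_ne_zero hπ.ne']
    have := Real.log_two_lt_d9
    have := log_pi_lt
    linarith
  have hlogU : 1 ≤ Real.log U := by
    rw [← Real.log_exp 1]
    refine Real.log_le_log (Real.exp_pos 1) ?_
    have := Real.exp_one_lt_d9
    linarith
  have h1 : 0 ≤ (Real.log U + 1 - Real.log (2 * π)) / (2 * π) * U⁻¹ := by
    have : 0 ≤ Real.log U + 1 - Real.log (2 * π) := by linarith
    positivity
  have h2 : (0.3725 : ℝ) / 3 * (U ^ 3)⁻¹ ≤ 6.67 / 2 * (U ^ 2)⁻¹ := by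
    rw [show (0.3725 : ℝ) / 3 * (U ^ 3)⁻¹ = (0.3725 / (3 * U)) * (U ^ 2)⁻¹ by field_simp]
    refine mul_le_mul_of_nonneg_right ?_ (by positivity)
    rw [div_le_iff₀ (by positivity)]
    nlinarith
  linarith

/-- **`∑_{T < Im ρ ≤ U} m(ρ)/(Im ρ)² ≤ G(T)` for `2516 ≤ T ≤ U`** (partial summation with `f = 1/t²`,
`N ≤ N⁺` on `[T, U]`, `N(T) ≥ N⁻(T)`; the result is `G(T)` minus the non-negative remainder of
`remainder_nonneg`). [cite: Schoenfeld1976, Lemma 9] -/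
theorem sum_zerosBetween_le_Gtail {T U : ℝ} (hT : 2516 ≤ T) (hU : T ≤ U) :
    ∑ ρ ∈ zerosBetween T U, (riemannZetaZeroOrder ρ : ℝ) * (ρ.im ^ 2)⁻¹ ≤ Gtail T := by
  have hT0 : 0 < T := by linarith
  have hU0 : 0 < U := by linarith
  have h := sum_zerosBetween_le_of_count_le (T₁ := T) (T₂ := U) hT0.le hU
    (f := fun t ↦ (t ^ 2)⁻¹) (f' := fun t ↦ -2 / t ^ 3) (Nup := nUp)
    (fun t ht ↦ hasDerivAt_inv_sq (by linarith [ht.1] : t ≠ 0))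
    (continuousOn_of_forall_continuousAt fun t ht ↦ by
      have h0 : t ≠ 0 := by linarith [ht.1]
      have h3 : t ^ 3 ≠ 0 := pow_ne_zero 3 h0
      fun_prop (disch := assumption))
    (fun t ht ↦ by
      have : 0 < t := by linarith [ht.1]
      exact div_nonpos_of_nonpos_of_nonneg (by norm_num) (by positivity))
    (by positivity) (fun t ht ↦ count_le_nUp (hT.trans ht.1)) (continuousOn_nUp hT0)
  -- replace `N(T)` by `N⁻(T)`
  have hN := nLo_le_count hT
  have hbd : (nUp U - zetaZeroCount T) * (U ^ 2)⁻¹ ≤ (nUp U - nLo T) * (U ^ 2)⁻¹ :=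
    mul_le_mul_of_nonneg_right (by linarith) (by positivity)
  have hcont : ∀ c : ℝ, ContinuousOn (fun t ↦ (nUp t - c) * -(-2 / t ^ 3)) (Icc T U) := fun c ↦
    continuousOn_of_forall_continuousAt fun t ht ↦ by
      have h0 : t ≠ 0 := by linarith [ht.1]
      have h3 : t ^ 3 ≠ 0 := pow_ne_zero 3 h0
      fun_prop (disch := assumption)
  have hint_le : ∫ t in T..U, (nUp t - zetaZeroCount T) * -(-2 / t ^ 3) ≤
      ∫ t in T..U, (nUp t - nLo T) * -(-2 / t ^ 3) := by
    refine integral_mono_on hU ((hcont _).intervalIntegrable_of_Icc hU)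
      ((hcont _).intervalIntegrable_of_Icc hU) fun t ht ↦ ?_
    have : 0 < t := by linarith [ht.1]
    have : 0 ≤ -(-2 / t ^ 3) := by rw [neg_div, neg_neg]; positivity
    nlinarith
  -- the integral in closed form
  have hint : ∫ t in T..U, (nUp t - nLo T) * -(-2 / t ^ 3) = Fb (nLo T) U - Fb (nLo T) T := by
    have e : ∀ t ∈ uIcc T U, (nUp t - nLo T) * -(-2 / t ^ 3) = (nUp t - nLo T) * (2 / t ^ 3) :=
      fun t _ ↦ by ring
    rw [integral_congr e]
    refine integral_eq_sub_of_hasDerivAt (fun t ht ↦ hasDerivAt_Fb _ ?_) ?_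
    · rw [uIcc_of_le hU] at ht; linarith [ht.1]
    · refine ContinuousOn.intervalIntegrable_of_Icc hU (continuousOn_of_forall_continuousAt fun t ht ↦ ?_)
      have h0 : t ≠ 0 := by linarith [ht.1]
      have h3 : t ^ 3 ≠ 0 := pow_ne_zero 3 h0
      fun_prop (disch := assumption)
  have hb := boundary_add_Fb_eq (nLo T) hU0
  have hr := remainder_nonneg (hT.trans hU)
  have hG := neg_Fb_nLo_eq hT0
  linarith

/-- **`β − sumInvNormSq T ≤ 2G(T)` for `T ≥ 2516`, under RH**: the contribution
`∑_{|Im ρ| > T} m(ρ)/|ρ|²` of the high zeros. [cite: Schoenfeld1976, Lemma 9] -/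
theorem tail_le_explicit (hRH : RiemannHypothesis) {T : ℝ} (hT : 2516 ≤ T) :
    nicolasBeta - sumInvNormSq T ≤ 2 * Gtail T :=
  tail_le_of_forall_sum_le hRH (by linarith) fun _ hU ↦ sum_zerosBetween_le_Gtail hT hU

end SchoenfeldBound

end Literature.NumberTheory.LFunctions

end
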